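import Mathlib
import HarnessLib
import Summits.HubbardSuperconductivity.HubbardSuperconductivity.Theorems.KLProgrammeKLRegimeVolumeLimitV9GluedSrcPairDoor
import Summits.HubbardSuperconductivity.HubbardSuperconductivity.Theorems.KLProgrammeKLRegimeTwoVolumeSourceReadoutAt
import Summits.HubbardSuperconductivity.HubbardSuperconductivity.Theorems.KLProgrammeKLRegimeTwoVolumeGluedRescaling

/-!
# Route `KLProgramme` — crux K3, VL child `KLRegimeVolumeLimitV17F2` (stmt-HubbardSuperconductivity-20440), skeleton «cauchy» v9 (831d58cbda4d66f6):
# THE REGISTERED STUB `stub_vl_nestedFramed` FROM THE SPINE'S LAST OBJECT AS IT ARRIVES — `srcTrunc 3 (map (toLin' (ε • klSrcAnalysisAt … J)) 𝒱_{n⋆})`,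
# alive family index `J` FREE, source-pair strings, keyed block-reduced defect, normalisation `2ε⁻¹·GLUED_ε ≤ δ`
# (cell gate-hubbard-kl, seat hubbard-kl-k3c5-p3 g13, technique «OS-positivity-free direct assembly»; k3c4-p1 g12's ask KL STATUS 2026-08-28 00:14Z)

Blueprint v5 (evidence #41; `…TwoVolumeSrcTowerIdentity`): the (vi) spine's last object at volume `V` is
`X_V := srcTrunc ℂ (·.2 = 1) 3 (map (toLin' (ε • klSrcAnalysisAt V M β μ K_V J)) (𝒱_{n⋆}[K_V]))` on `SrcLabel V M J` legs (alive family `F_J`, `J = n⋆ − 2`;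
every leg carries `ε = imagTimeWeight β M`; own top flow frame `K_V`), keyed by `exists_doubledEquiv ∘ exists_sectorFieldBlockEquiv` at `N = sectorCount J`;
M3d-wt's conclusion for the pair `(X_{L″}, X_L)` at an `Rd(L)`-deep pin, tracked as `ε⁻¹·defect`, is its last line.  This file types the END door for THAT pair:

* §1 `kernel_map_smul_klSrcAnalysisAt` (`kernel (map (toLin' (c • klSrcAnalysisAt … J)) 𝒱_n) m X = c^m · kernel (klSrcActionAt … J n) m X`, by
  `map_toLin'_eq_map_mulLeft_map_of_rowScale` + `kernel_map_mulLeft`), the source-pair kernels of `X_V` on slot-`0` strings (`= c²·` the plain two-point kernels of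
  `𝒱_n`, `J`-free) and on dead strings (`= 0`);
* §2 **`sq_mul_srcPairSum_le_srcPairSumAt`**: `‖c‖² ·` (the e-free source-pair glued sum of the v9 objects `srcTrunc 3 (klSrcAction V … n)`, pin in `SrcLabel … n`) `≤`
  (the e-free source-pair glued sum of the `c`-scaled `J`-objects, pin in `SrcLabel … J`) — dead second legs give `0` on both sides of both, slot-`0` strings relabel
  injectively with the same sites (same block test, same residues) and kernels `× c²`;
* §3 **`stub_vl_nestedFramed_of_gluedSrcDefect_keyedAt`**: the REGISTERED v9 type of `stub_vl_nestedFramed` (conclusion byte-identical to p582054's) from: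
  inside the VL binders under the tower, `∃ L₀, ∃ δ → 0, ∃ Rd → ∞, ∀ L ≥ L₀, ∀ L″ = b·L, ∃ M₀, ∀ M ≥ M₀, ∃ J, ∃ e ed (he1, he2, hed at sectorCount J),
  ∃ o_f (Rd L)-deep, 2·ε⁻¹·Σ_{X : X 0 = ((o_f,((0,0),0)),1), (X 1).2 = 1} ‖kernel X_{L″} 2 X − (if ∀ i, (ed (X i)).1 = (ed (X 0)).1 then kernel X_L 2 (ed∘X).2 else 0)‖ ≤ δ L`
  — via §2 (`2ε·S_{n⋆} = 2ε⁻¹·(ε²·S_{n⋆}) ≤ 2ε⁻¹·S_J`), `keyedReduced_eq_ite`, and `stub_vl_nestedFramed_of_gluedSrcDefect` (p588106).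

Proofs only; no definition; nothing asserts superconductivity.  References: BGM 2006 §2.7 (2.70)–(2.71), §2.9 (4.3)–(4.6); Salmhofer 1999 (2.102)–(2.106).
-/

noncomputable section

/-! ## §1–§2 Source-pair kernels of the `c`-scaled decoupled objects; the comparison with the v9 objects -/

namespace Summit.HubbardSuperconductivity.HubbardSuperconductivity.Theorems.TwoVolumeSource

set_option linter.dupNamespace false -- summit = problem name (single-conjunct summit), D-0017

open Finset Literature.MathematicalPhysics.QuantumLattice Literature.Probability.LatticeModels GrassmannAlgebra
open Summit.HubbardSuperconductivity.HubbardSuperconductivity.Theorems.KLProgrammeLegKernels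
open Summit.HubbardSuperconductivity.HubbardSuperconductivity.Theorems.KLRegimeSplit
open Summit.HubbardSuperconductivity.HubbardSuperconductivity.Theorems.TwoVolumeDefect
open Summit.HubbardSuperconductivity.HubbardSuperconductivity.Theorems.EngineV8

section ScaledKernels

variable {L M : ℕ} [NeZero L]

omit [NeZero L] in
/-- A scalar multiple of the decoupled analysis matrix is a row scaling by the constant weight. [folklore] -/
theorem smul_klSrcAnalysisAt_apply (c : ℂ) (β μ : ℝ) (K : TrigPolyC4v) (J : ℕ) (p : SrcLabel L M J) (X : HubbardFieldIdx L M) :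
    (c • klSrcAnalysisAt L M β μ K J) p X = (fun _ : SrcLabel L M J => c) p * klSrcAnalysisAt L M β μ K J p X := by
  rw [Matrix.smul_apply, smul_eq_mul]

/-- **Kernels of the `c`-scaled decoupled object**: `kernel (map (toLin' (c • klSrcAnalysisAt … J)) 𝒱_n) m X = c^m · kernel (klSrcActionAt … J n) m X`.
[cite: BenfattoGiulianiMastropietro2006, §2.7 (2.70)-(2.71)] -/
theorem kernel_map_smul_klSrcAnalysisAt (c : ℂ) (β U μ : ℝ) (K : TrigPolyC4v) (J n m : ℕ) (X : Fin m → SrcLabel L M J) :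
    kernel ℂ (ExteriorAlgebra.map (Matrix.toLin' (c • klSrcAnalysisAt L M β μ K J)) (klEffectiveAction L M β U μ K klE0 n)) m X =
      c ^ m * kernel ℂ (klSrcActionAt L M β U μ K J n) m X := by
  rw [map_toLin'_eq_map_mulLeft_map_of_rowScale (fun _ : SrcLabel L M J => c) (c • klSrcAnalysisAt L M β μ K J) (klSrcAnalysisAt L M β μ K J)
      (smul_klSrcAnalysisAt_apply c β μ K J) (klEffectiveAction L M β U μ K klE0 n), kernel_map_mulLeft, Fin.prod_const]
  rfl

/-- Source-pair kernels of the `c`-scaled decoupled object through `srcTrunc 3`, on SLOT-`0` source strings: `c² ·` the plain two-point kernel of `𝒱_n` (`J`-free).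
[cite: BenfattoGiulianiMastropietro2006, §2.9 (4.3)-(4.6)] -/
theorem kernel_srcTrunc_map_smul_klSrcAnalysisAt_src_two (c : ℂ) (β U μ : ℝ) (K : TrigPolyC4v) (J n : ℕ) (X : Fin 2 → SrcLabel L M J)
    (hX : ∀ i, (X i).2 = 1) (h0 : ∀ i, ((X i).1.2.1.1 : ℕ) = 0) :
    kernel ℂ (srcTrunc ℂ (fun Y : SrcLabel L M J => Y.2 = 1) 3
        (ExteriorAlgebra.map (Matrix.toLin' (c • klSrcAnalysisAt L M β μ K J)) (klEffectiveAction L M β U μ K klE0 n))) 2 X =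
      c ^ 2 * sectorisedKernel L M β (trivialMultiplier L M) (klEffectiveAction L M β U μ K klE0 n) 2
        (fun i => ((((0 : Fin 1), (X i).1.2.1.2), (X i).1.2.2) : SectorLeg 1)) (fun i => (X i).1.1) := by
  rw [kernel_srcTrunc_three_two, kernel_map_smul_klSrcAnalysisAt, kernel_klSrcActionAt_src β U μ K J n 2 X hX h0]

/-- Source-pair kernels of the `c`-scaled decoupled object through `srcTrunc 3` VANISH on strings with a dead source leg. [folklore] -/
theorem kernel_srcTrunc_map_smul_klSrcAnalysisAt_dead_two (c : ℂ) (β U μ : ℝ) (K : TrigPolyC4v) (J n : ℕ) (X : Fin 2 → SrcLabel L M J) {i : Fin 2}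
    (hX : (X i).2 = 1) (h0 : ((X i).1.2.1.1 : ℕ) ≠ 0) :
    kernel ℂ (srcTrunc ℂ (fun Y : SrcLabel L M J => Y.2 = 1) 3
        (ExteriorAlgebra.map (Matrix.toLin' (c • klSrcAnalysisAt L M β μ K J)) (klEffectiveAction L M β U μ K klE0 n))) 2 X = 0 := by
  rw [kernel_srcTrunc_three_two, kernel_map_smul_klSrcAnalysisAt, kernel_klSrcActionAt_eq_zero_of_dead β U μ K J n 2 X hX h0, mul_zero]

/-- Source-pair kernels of the v9 object `srcTrunc 3 (klSrcAction … n)` VANISH on strings with a dead source leg. [folklore] -/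
theorem kernel_srcTrunc_klSrcAction_dead_two (β U μ : ℝ) (K : TrigPolyC4v) (n : ℕ) (X : Fin 2 → SrcLabel L M n) {i : Fin 2}
    (hX : (X i).2 = 1) (h0 : ((X i).1.2.1.1 : ℕ) ≠ 0) :
    kernel ℂ (srcTrunc ℂ (fun Y : SrcLabel L M n => Y.2 = 1) 3 (klSrcAction L M β U μ K n)) 2 X = 0 := by
  rw [kernel_srcTrunc_three_two, kernel_klSrcAction_eq_zero_of_dead β U μ K n 2 X hX h0]

/-- Source-pair kernels of the v9 object through `srcTrunc 3` on slot-`0` source strings: the plain two-point kernel of `𝒱_n`. [folklore] -/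
theorem kernel_srcTrunc_klSrcAction_src_two (β U μ : ℝ) (K : TrigPolyC4v) (n : ℕ) (X : Fin 2 → SrcLabel L M n)
    (hX : ∀ i, (X i).2 = 1) (h0 : ∀ i, ((X i).1.2.1.1 : ℕ) = 0) :
    kernel ℂ (srcTrunc ℂ (fun Y : SrcLabel L M n => Y.2 = 1) 3 (klSrcAction L M β U μ K n)) 2 X =
      sectorisedKernel L M β (trivialMultiplier L M) (klEffectiveAction L M β U μ K klE0 n) 2
        (fun i => ((((0 : Fin 1), (X i).1.2.1.2), (X i).1.2.2) : SectorLeg 1)) (fun i => (X i).1.1) := by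
  rw [kernel_srcTrunc_three_two, kernel_klSrcAction_src β U μ K n 2 X hX h0]

end ScaledKernels

section Compare

variable {b L Lf M : ℕ} [NeZero Lf] [NeZero L]

/-- **`‖c‖² · S_n ≤ S_J`**: the e-free source-pair glued pinned sum of the v9 pair `(srcTrunc 3 (klSrcAction L″ … n), srcTrunc 3 (klSrcAction L … n))` at the
source pin `((o_f,(0,a,σ)),1) ∈ SrcLabel … n`, times `‖c‖²`, is at most the same sum for the `c`-scaled decoupled pair
`(srcTrunc 3 (map (c • klSrcAnalysisAt L″ … J) 𝒱″_n), srcTrunc 3 (map (c • klSrcAnalysisAt L … J) 𝒱_n))` at the twin pin in `SrcLabel … J` — any frames, any `J`.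
[cite: BenfattoGiulianiMastropietro2006, §2.9 (4.3)-(4.6)] -/
theorem sq_mul_srcPairSum_le_srcPairSumAt (c : ℂ) (β U μ : ℝ) (Kc Kf : TrigPolyC4v) (J n : ℕ) (of : SpaceTimeIdx Lf M) (a σ : Fin 2) :
    ‖c‖ ^ 2 * ∑ X ∈ univ.filter (fun X : Fin 2 → SrcLabel Lf M n => X 0 = ((of, ((⟨0, sectorCount_pos n⟩, a), σ)), 1) ∧ (X 1).2 = 1),
        ‖kernel ℂ (srcTrunc ℂ (fun Y : SrcLabel Lf M n => Y.2 = 1) 3 (klSrcAction Lf M β U μ Kf n)) 2 X -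
            (if ∀ i j, ((X i).1.1.2 j).val / L = ((X 0).1.1.2 j).val / L then
              kernel ℂ (srcTrunc ℂ (fun Y : SrcLabel L M n => Y.2 = 1) 3 (klSrcAction L M β U μ Kc n)) 2
                (fun i => ((((X i).1.1.1, fun j => ((((X i).1.1.2 j).val : ℕ) : ZMod L)), (X i).1.2), (X i).2))
            else 0)‖ ≤
      ∑ X ∈ univ.filter (fun X : Fin 2 → SrcLabel Lf M J => X 0 = ((of, ((⟨0, sectorCount_pos J⟩, a), σ)), 1) ∧ (X 1).2 = 1),
        ‖kernel ℂ (srcTrunc ℂ (fun Y : SrcLabel Lf M J => Y.2 = 1) 3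
              (ExteriorAlgebra.map (Matrix.toLin' (c • klSrcAnalysisAt Lf M β μ Kf J)) (klEffectiveAction Lf M β U μ Kf klE0 n))) 2 X -
            (if ∀ i j, ((X i).1.1.2 j).val / L = ((X 0).1.1.2 j).val / L then
              kernel ℂ (srcTrunc ℂ (fun Y : SrcLabel L M J => Y.2 = 1) 3
                (ExteriorAlgebra.map (Matrix.toLin' (c • klSrcAnalysisAt L M β μ Kc J)) (klEffectiveAction L M β U μ Kc klE0 n))) 2
                (fun i => ((((X i).1.1.1, fun j => ((((X i).1.1.2 j).val : ℕ) : ZMod L)), (X i).1.2), (X i).2))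
            else 0)‖ := by
  classical
  -- names: the four objects, the summands, the pins, the filters, the relabelling
  set An' := srcTrunc ℂ (fun Y : SrcLabel Lf M n => Y.2 = 1) 3 (klSrcAction Lf M β U μ Kf n) with hAn'
  set An := srcTrunc ℂ (fun Y : SrcLabel L M n => Y.2 = 1) 3 (klSrcAction L M β U μ Kc n) with hAn
  set AJ' := srcTrunc ℂ (fun Y : SrcLabel Lf M J => Y.2 = 1) 3
    (ExteriorAlgebra.map (Matrix.toLin' (c • klSrcAnalysisAt Lf M β μ Kf J)) (klEffectiveAction Lf M β U μ Kf klE0 n)) with hAJ'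
  set AJ := srcTrunc ℂ (fun Y : SrcLabel L M J => Y.2 = 1) 3
    (ExteriorAlgebra.map (Matrix.toLin' (c • klSrcAnalysisAt L M β μ Kc J)) (klEffectiveAction L M β U μ Kc klE0 n)) with hAJ
  let gn : (Fin 2 → SrcLabel Lf M n) → ℝ := fun X =>
    ‖kernel ℂ An' 2 X - (if ∀ i j, ((X i).1.1.2 j).val / L = ((X 0).1.1.2 j).val / L then
        kernel ℂ An 2 (fun i => ((((X i).1.1.1, fun j => ((((X i).1.1.2 j).val : ℕ) : ZMod L)), (X i).1.2), (X i).2)) else 0)‖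
  let gJ : (Fin 2 → SrcLabel Lf M J) → ℝ := fun X =>
    ‖kernel ℂ AJ' 2 X - (if ∀ i j, ((X i).1.1.2 j).val / L = ((X 0).1.1.2 j).val / L then
        kernel ℂ AJ 2 (fun i => ((((X i).1.1.1, fun j => ((((X i).1.1.2 j).val : ℕ) : ZMod L)), (X i).1.2), (X i).2)) else 0)‖
  set wn : SrcLabel Lf M n := ((of, ((⟨0, sectorCount_pos n⟩, a), σ)), 1) with hwn
  set wJ : SrcLabel Lf M J := ((of, ((⟨0, sectorCount_pos J⟩, a), σ)), 1) with hwJ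
  let Fn : Finset (Fin 2 → SrcLabel Lf M n) := univ.filter (fun X => X 0 = wn ∧ (X 1).2 = 1)
  let FJ : Finset (Fin 2 → SrcLabel Lf M J) := univ.filter (fun X => X 0 = wJ ∧ (X 1).2 = 1)
  let ψ : (Fin 2 → SrcLabel Lf M n) → (Fin 2 → SrcLabel Lf M J) := fun X i =>
    ((((X i).1.1, ((⟨0, sectorCount_pos J⟩, (X i).1.2.1.2), (X i).1.2.2)), (X i).2) : SrcLabel Lf M J)
  let S0 : (Fin 2 → SrcLabel Lf M n) → Prop := fun X => ((X 1).1.2.1.1 : ℕ) = 0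
  show ‖c‖ ^ 2 * ∑ X ∈ Fn, gn X ≤ ∑ X ∈ FJ, gJ X
  have hgJ0 : ∀ X, 0 ≤ gJ X := fun X => norm_nonneg _
  -- (1) strings with a DEAD second leg contribute nothing to the v9 sum
  have hall : ∀ X ∈ Fn, ∀ i, (X i).2 = 1 := by
    intro X hX i
    simp only [Fn, mem_filter, mem_univ, true_and] at hX
    fin_cases i
    · show (X 0).2 = 1
      rw [hX.1]
    · exact hX.2
  have hdead : ∑ X ∈ Fn.filter (fun X => ¬ S0 X), gn X = 0 := by
    refine sum_eq_zero fun X hX => ?_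
    have hXF : X ∈ Fn := (mem_filter.1 hX).1
    have hns : ¬ S0 X := (mem_filter.1 hX).2
    have h1 : (X 1).2 = 1 := hall X hXF 1
    have hf : kernel ℂ An' 2 X = 0 := kernel_srcTrunc_klSrcAction_dead_two β U μ Kf n X (i := 1) h1 hns
    have hc' : kernel ℂ An 2 (fun i => ((((X i).1.1.1, fun j => ((((X i).1.1.2 j).val : ℕ) : ZMod L)), (X i).1.2), (X i).2)) = 0 :=
      kernel_srcTrunc_klSrcAction_dead_two β U μ Kc n _ (i := 1) h1 hns
    show ‖kernel ℂ An' 2 X - _‖ = 0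
    rw [hf, hc', ite_self, sub_zero, norm_zero]
  have hsplit : ∑ X ∈ Fn, gn X = ∑ X ∈ Fn.filter S0, gn X := by
    rw [← sum_filter_add_sum_filter_not Fn S0, hdead, add_zero]
  -- (2) slot-`0` strings: both legs are slot-`0` sources
  have hslot : ∀ X ∈ Fn.filter S0, ∀ i, (X i).2 = 1 ∧ ((X i).1.2.1.1 : ℕ) = 0 := by
    intro X hX i
    have hXF : X ∈ Fn := (mem_filter.1 hX).1
    refine ⟨hall X hXF i, ?_⟩
    fin_cases i
    · have h0 : X 0 = wn := by
        have := (mem_filter.1 hXF).2.1; exact this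
      show ((X 0).1.2.1.1 : ℕ) = 0
      rw [h0]
    · exact (mem_filter.1 hX).2
  have hψinj : ∀ X ∈ Fn.filter S0, ∀ X' ∈ Fn.filter S0, ψ X = ψ X' → X = X' := by
    intro X hX X' hX' h
    funext i
    have hi := congrFun h i
    simp only [ψ, Prod.mk.injEq] at hi
    obtain ⟨⟨hx, ⟨-, hk2⟩, hσ⟩, hc⟩ := hi
    have hk1 : ((X i).1.2.1.1 : ℕ) = ((X' i).1.2.1.1 : ℕ) := by rw [(hslot X hX i).2, (hslot X' hX' i).2]
    exact Prod.ext (Prod.ext hx (Prod.ext (Prod.ext (Fin.ext hk1) hk2) hσ)) hc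
  -- (3) termwise: `‖c‖² · gn X = gJ (ψ X)` on slot-`0` strings
  have hterm : ∀ X ∈ Fn.filter S0, ‖c‖ ^ 2 * gn X = gJ (ψ X) := by
    intro X hX
    have hs := hslot X hX
    -- the four kernels
    have hf : kernel ℂ AJ' 2 (ψ X) = c ^ 2 * kernel ℂ An' 2 X := by
      rw [hAJ', kernel_srcTrunc_map_smul_klSrcAnalysisAt_src_two c β U μ Kf J n (ψ X) (fun i => (hs i).1) (fun i => rfl),
        hAn', kernel_srcTrunc_klSrcAction_src_two β U μ Kf n X (fun i => (hs i).1) (fun i => (hs i).2)]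
    have hcoarse : kernel ℂ AJ 2 (fun i => ((((ψ X i).1.1.1, fun j => ((((ψ X i).1.1.2 j).val : ℕ) : ZMod L)), (ψ X i).1.2), (ψ X i).2)) =
        c ^ 2 * kernel ℂ An 2 (fun i => ((((X i).1.1.1, fun j => ((((X i).1.1.2 j).val : ℕ) : ZMod L)), (X i).1.2), (X i).2)) := by
      rw [hAJ, kernel_srcTrunc_map_smul_klSrcAnalysisAt_src_two c β U μ Kc J n _ (fun i => (hs i).1) (fun i => rfl),
        hAn, kernel_srcTrunc_klSrcAction_src_two (L := L) β U μ Kc n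
          (fun i => (((((X i).1.1.1, fun j => ((((X i).1.1.2 j).val : ℕ) : ZMod L)), (X i).1.2), (X i).2) : SrcLabel L M n))
          (fun i => (hs i).1) (fun i => (hs i).2)]
    -- the block tests coincide (same sites)
    have htest : (∀ i j, ((ψ X i).1.1.2 j).val / L = ((ψ X 0).1.1.2 j).val / L) ↔ ∀ i j, ((X i).1.1.2 j).val / L = ((X 0).1.1.2 j).val / L := Iff.rfl
    show ‖c‖ ^ 2 * ‖kernel ℂ An' 2 X - _‖ = ‖kernel ℂ AJ' 2 (ψ X) - _‖
    rw [hf, hcoarse]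
    by_cases h : ∀ i j, ((X i).1.1.2 j).val / L = ((X 0).1.1.2 j).val / L
    · rw [if_pos h, if_pos (htest.2 h), ← mul_sub, norm_mul, norm_pow]
    · rw [if_neg h, if_neg (fun h' => h (htest.1 h')), sub_zero, sub_zero, norm_mul, norm_pow]
  have hmem : ∀ X ∈ Fn.filter S0, ψ X ∈ FJ := by
    intro X hX
    have hXF : X ∈ Fn := (mem_filter.1 hX).1
    have hX0 : X 0 = wn := (mem_filter.1 hXF).2.1
    refine mem_filter.2 ⟨mem_univ _, ?_, (hslot X hX 1).1⟩
    show ψ X 0 = wJ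
    simp only [ψ, hX0, hwn, hwJ]
  calc ‖c‖ ^ 2 * ∑ X ∈ Fn, gn X = ∑ X ∈ Fn.filter S0, ‖c‖ ^ 2 * gn X := by rw [hsplit, mul_sum]
    _ = ∑ X ∈ Fn.filter S0, gJ (ψ X) := sum_congr rfl hterm
    _ = ∑ X ∈ (Fn.filter S0).image ψ, gJ X := (sum_image hψinj).symm
    _ ≤ ∑ X ∈ FJ, gJ X := sum_le_sum_of_subset_of_nonneg (fun X hX => by
        obtain ⟨Y, hY, rfl⟩ := mem_image.1 hX; exact hmem Y hY) fun X _ _ => hgJ0 X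

end Compare

end Summit.HubbardSuperconductivity.HubbardSuperconductivity.Theorems.TwoVolumeSource

/-! ## §3 The door for the spine's last object -/

namespace Summit.HubbardSuperconductivity.HubbardSuperconductivity.Theorems.TwoPointAssembly

set_option linter.dupNamespace false -- summit = problem name (single-conjunct summit), D-0017

open Finset Filter Topology Complex Literature.MathematicalPhysics.QuantumLattice Literature.Probability.LatticeModels GrassmannAlgebra
open Summit.HubbardSuperconductivity.HubbardSuperconductivity.Theorems.KLRegimeSplit
open Summit.HubbardSuperconductivity.HubbardSuperconductivity.Theorems.KLProgrammeLegKernels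
open Summit.HubbardSuperconductivity.HubbardSuperconductivity.Theorems.EngineV8
open Summit.HubbardSuperconductivity.HubbardSuperconductivity.Theorems.TwoVolumeDefect
open Summit.HubbardSuperconductivity.HubbardSuperconductivity.Theorems.TwoVolumeSource

/-- `2ε·S = 2ε⁻¹·(ε²·S)` for `ε ≠ 0`. [folklore] -/
theorem two_mul_eps_eq (ε S : ℝ) (hε : ε ≠ 0) : 2 * ε * S = 2 * ε⁻¹ * (ε ^ 2 * S) := by
  field_simp

/-- **THE v9 STUB FROM THE SPINE'S LAST OBJECT** (blueprint v5 §1 TOP / §3): the keyed block-reduced defect of the pair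
`X_V = srcTrunc 3 (map (toLin' (ε • klSrcAnalysisAt V M β μ K_V J)) 𝒱_{n⋆}[K_V])` (`V = L″, L`; any alive index `J`; `ε = imagTimeWeight β M`) summed over the
SOURCE-PAIR strings at an `(Rd L)`-deep source pin, normalised as the spine tracks it (`2ε⁻¹·GLUED_ε ≤ δ L`), closes the registered `stub_vl_nestedFramed`.
[cite: BenfattoGiulianiMastropietro2006, §2.9 (4.3)-(4.6)] -/
theorem stub_vl_nestedFramed_of_gluedSrcDefect_keyedAt
    (hGlued : ∀ (G : GeoConsts) (P : SplitConsts) (Q : EngConsts) (R : RenConsts), G.WF → P.WF → Q.WF → R.WF →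
      ∃ c₅ : ℝ, 0 < c₅ ∧ ∀ c : ℝ, 0 < c → c ≤ c₅ → ∃ U₀ : ℝ, 0 < U₀ ∧
        ∀ μ ∈ klWindowC, ∀ U : ℝ, 0 < U → U ≤ U₀ → ∀ β : ℝ, klBetaMin ≤ β → β ≤ Real.exp (c / U ^ 2) →
          ∀ K : TrigPolyC4v, klPredsV17F2.frameOK R U (nScales β) μ K →
            ∀ (Lstar : ℕ) (Mstar : ℕ → ℕ), TowerP klPredsV17F2 G P Q R β U μ K Lstar Mstar →
              ∃ L₀ : ℕ, ∃ δ : ℕ → ℝ, Tendsto δ atTop (𝓝 0) ∧ ∃ Rd : ℕ → ℕ, Tendsto Rd atTop atTop ∧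
                ∀ (L : ℕ) [NeZero L], L₀ ≤ L → ∀ (L'' : ℕ) [NeZero L''] (b : ℕ), L'' = b * L → ∃ M₀ : ℕ, ∀ (M : ℕ) [NeZero M], M₀ ≤ M →
                  ∃ (J : ℕ) (e : (SpaceTimeIdx L'' M × SectorLeg (sectorCount J)) ≃ (Fin 2 → Fin b) × (SpaceTimeIdx L M × SectorLeg (sectorCount J)))
                    (ed : SrcLabel L'' M J ≃ (Fin 2 → Fin b) × SrcLabel L M J),
                    (∀ X' i, ((e X').1 i : ℕ) = (X'.1.2 i).val / L) ∧
                    (∀ X', (e X').2 = ((X'.1.1, fun i => (((X'.1.2 i).val : ℕ) : ZMod L)), X'.2)) ∧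
                    (∀ x s, ed (x, s) = ((e x).1, ((e x).2, s))) ∧
                  ∃ of : SpaceTimeIdx L'' M, (∀ j, Rd L ≤ (of.2 j).val % L ∧ (of.2 j).val % L + Rd L < L) ∧
                    2 * (imagTimeWeight β M)⁻¹ *
                      (∑ X ∈ univ.filter (fun X : Fin 2 → SrcLabel L'' M J => X 0 = ((of, ((⟨0, sectorCount_pos _⟩, 0), 0)), 1) ∧ (X 1).2 = 1),
                        ‖kernel ℂ (srcTrunc ℂ (fun Y : SrcLabel L'' M J => Y.2 = 1) 3
                              (ExteriorAlgebra.map (Matrix.toLin' (((imagTimeWeight β M : ℝ) : ℂ) •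
                                  klSrcAnalysisAt L'' M β μ (klFlowFrameU L'' M β U μ (nScales β + 1)) J))
                                (klEffectiveAction L'' M β U μ (klFlowFrameU L'' M β U μ (nScales β + 1)) klE0 (nScales β + 1)))) 2 X -
                            (if ∀ i, (ed (X i)).1 = (ed (X 0)).1 then
                              kernel ℂ (srcTrunc ℂ (fun Y : SrcLabel L M J => Y.2 = 1) 3
                                (ExteriorAlgebra.map (Matrix.toLin' (((imagTimeWeight β M : ℝ) : ℂ) •
                                    klSrcAnalysisAt L M β μ (klFlowFrameU L M β U μ (nScales β + 1)) J))
                                  (klEffectiveAction L M β U μ (klFlowFrameU L M β U μ (nScales β + 1)) klE0 (nScales β + 1)))) 2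
                                (fun i => (ed (X i)).2)
                            else 0)‖) ≤ δ L) :
    (∀ (P : SplitConsts) (R : RenConsts), P.WF → R.WF2 →
      ∃ Q' : EngConsts, 0 ≤ Q'.CE ∧ ∃ c₀ : ℝ, 0 < c₀ ∧ ∀ c : ℝ, 0 < c → c ≤ c₀ → ∃ U₀ : ℝ, 0 < U₀ ∧
        ∀ μ ∈ klWindowC, ∀ U : ℝ, 0 < U → U ≤ U₀ → ∀ β : ℝ, klBetaMin ≤ β → β ≤ Real.exp (c / U ^ 2) →
          ∃ A : ℕ → ℕ → ℝ, ∃ L₁ : ℕ, ∃ M₁ : ℕ → ℕ, ∀ (L M : ℕ) [NeZero L] [NeZero M], L₁ ≤ L → M₁ L ≤ M →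
            ∀ j : ℕ, j ≤ nScales β + 1 →
              SourceProfilesAt L M (klSrcBudget P Q' U A j) β U μ (klFlowFrameU L M β U μ (nScales β + 1)) j) →
    ∀ (G : GeoConsts) (P : SplitConsts) (Q : EngConsts) (R : RenConsts), G.WF → P.WF → Q.WF → R.WF →
      ∃ c₅ : ℝ, 0 < c₅ ∧ ∀ c : ℝ, 0 < c → c ≤ c₅ → ∃ U₀ : ℝ, 0 < U₀ ∧
        ∀ μ ∈ klWindowC, ∀ U : ℝ, 0 < U → U ≤ U₀ → ∀ β : ℝ, klBetaMin ≤ β → β ≤ Real.exp (c / U ^ 2) →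
          ∀ K : TrigPolyC4v, klPredsV17F2.frameOK R U (nScales β) μ K →
            ∀ (Lstar : ℕ) (Mstar : ℕ → ℕ), TowerP klPredsV17F2 G P Q R β U μ K Lstar Mstar →
              ∀ n : ℤ, ∃ L₀ : ℕ, ∃ ρ : ℕ → ℝ, Tendsto ρ atTop (𝓝 0) ∧
                ∀ (L : ℕ) [NeZero L], L₀ ≤ L → ∀ (L'' : ℕ) [NeZero L''], L ∣ L'' → ∃ M₀ : ℕ, ∀ (M : ℕ) [NeZero M], M₀ ≤ M →
                  ∀ (ω : MatsubaraIdx M), matsubaraInt M ω = n → ∀ (k : TorusSite 2 L) (k'' : TorusSite 2 L''),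
                    latticeMomentum L'' k'' = latticeMomentum L k →
                      ‖klSelfEnergy L M β U μ (klFlowFrameU L M β U μ (nScales β + 1)) klE0 (nScales β + 1) (ω, k) 0 -
                          klSelfEnergy L'' M β U μ (klFlowFrameU L'' M β U μ (nScales β + 1)) klE0 (nScales β + 1) (ω, k'') 0‖ ≤ ρ L := by
  refine stub_vl_nestedFramed_of_gluedSrcDefect fun G P Q R hG hP hQ hR => ?_
  obtain ⟨c₅, hc₅, hc⟩ := hGlued G P Q R hG hP hQ hR
  refine ⟨c₅, hc₅, fun c hc0 hcc => ?_⟩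
  obtain ⟨U₀, hU₀, hU⟩ := hc c hc0 hcc
  refine ⟨U₀, hU₀, fun μ hμ U hU0 hUU β hβmin hβmax K hK Lstar Mstar hT => ?_⟩
  have hβ : 0 < β := pos_of_klBetaMin_le hβmin
  obtain ⟨L₀, δ, hδ, Rd, hRd, hDn⟩ := hU μ hμ U hU0 hUU β hβmin hβmax K hK Lstar Mstar hT
  refine ⟨L₀, δ, hδ, Rd, hRd, fun L _ hL L'' _ b hb => ?_⟩
  obtain ⟨M₀, hM₀⟩ := hDn L hL L'' b hb
  refine ⟨M₀, fun M _ hM => ?_⟩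
  obtain ⟨J, e, ed, he1, he2, hed, of, hof, hglued⟩ := hM₀ M hM
  refine ⟨of, hof, ?_⟩
  -- `ε > 0`, and `2ε·S_n = 2ε⁻¹·(ε²·S_n) ≤ 2ε⁻¹·S_J(e-free) = 2ε⁻¹·S_J(keyed) ≤ δ L`
  have hMpos : (0 : ℝ) < M := Nat.cast_pos.2 (Nat.pos_of_ne_zero (NeZero.ne M))
  have hε : 0 < imagTimeWeight β M := by unfold imagTimeWeight; positivity
  have hsq : ‖((imagTimeWeight β M : ℝ) : ℂ)‖ ^ 2 = imagTimeWeight β M ^ 2 := by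
    rw [Complex.norm_real, Real.norm_of_nonneg hε.le]
  have hcmp := sq_mul_srcPairSum_le_srcPairSumAt (L := L) ((imagTimeWeight β M : ℝ) : ℂ) β U μ
    (klFlowFrameU L M β U μ (nScales β + 1)) (klFlowFrameU L'' M β U μ (nScales β + 1)) J (nScales β + 1) of 0 0
  rw [hsq] at hcmp
  refine le_trans ?_ hglued
  have hkey : ∀ X : Fin 2 → SrcLabel L'' M J,
      (if ∀ i, (ed (X i)).1 = (ed (X 0)).1 then
          kernel ℂ (srcTrunc ℂ (fun Y : SrcLabel L M J => Y.2 = 1) 3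
            (ExteriorAlgebra.map (Matrix.toLin' (((imagTimeWeight β M : ℝ) : ℂ) •
                klSrcAnalysisAt L M β μ (klFlowFrameU L M β U μ (nScales β + 1)) J))
              (klEffectiveAction L M β U μ (klFlowFrameU L M β U μ (nScales β + 1)) klE0 (nScales β + 1)))) 2 (fun i => (ed (X i)).2)
        else 0) =
      if ∀ i j, ((X i).1.1.2 j).val / L = ((X 0).1.1.2 j).val / L then
          kernel ℂ (srcTrunc ℂ (fun Y : SrcLabel L M J => Y.2 = 1) 3
            (ExteriorAlgebra.map (Matrix.toLin' (((imagTimeWeight β M : ℝ) : ℂ) •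
                klSrcAnalysisAt L M β μ (klFlowFrameU L M β U μ (nScales β + 1)) J))
              (klEffectiveAction L M β U μ (klFlowFrameU L M β U μ (nScales β + 1)) klE0 (nScales β + 1)))) 2
            (fun i => ((((X i).1.1.1, fun j => ((((X i).1.1.2 j).val : ℕ) : ZMod L)), (X i).1.2), (X i).2))
        else 0 := fun X => keyedReduced_eq_ite e ed he1 he2 hed _ 0 X
  simp only [hkey]
  calc 2 * imagTimeWeight β M * _ = 2 * (imagTimeWeight β M)⁻¹ * (imagTimeWeight β M ^ 2 * _) := two_mul_eps_eq _ _ hε.ne'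
    _ ≤ 2 * (imagTimeWeight β M)⁻¹ * _ := mul_le_mul_of_nonneg_left hcmp (by positivity)

end Summit.HubbardSuperconductivity.HubbardSuperconductivity.Theorems.TwoPointAssembly

end
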